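import Summits.QuantumFields.YangMills.Theorems.FluctuationComparisonRegPrIntLWregChartChainLetters
import Literature.MathematicalPhysics.QuantumFieldTheory.Balaban1983to89.T4TriangularPushforward
import HarnessLib

/-!
# LINE g18-2 «wreg_chart» (20520 organ WREG) — chain letters, part 5: BLINDNESS of the one-variable chain and of its iterated window to
# resampling all level-`n` pivot coordinates, and Haar-null transport ALONG the chain

Cell `ym3-torus`, width seat `ym3-torus-px17` g6 (helper of `stmt-QuantumFields-20520`, `--supports`, count-neutral).  Same device as parts 2–4: the
line's `iterCentralBond` ∕ `chainMap` ∕ `chainWindow` enter as families `icb` ∕ `cm` ∕ `cw` under their recursion equations (each `rfl` for the line).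
These are the Theorems-side editions of the line's in-file `chainMap_extend` ∕ `iter_extend_eq` ∕ `chainWindow_extend` ∕ `chain_imageNull`
(`Lines/wreg_chart.lean` v17 §0), i.e. exactly the chain hypotheses `hext_cm` ∕ `hext_cw` ∕ `hN` of w4-20520 g14's ✓`…WregChartLevelNear.levelFlatNear_of_chain`
(the remaining three, `hinj` ∕ `hmeas_cw` ∕ `hmeas_cm`, are part 2's `injOn_cm` ∕ `measurableSet_cw_prod` ∕ `measurable_cm_prod`).

CONTENT.  §1 resampling algebra (`update_extend_eq`, `extend_comp_eq`) and injectivity of the iterated central bond from its recursion (`icb_injective`);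
§2 ★`cm_extend` (the chain at `c` is blind to resampling ALL level-`n` pivots — locality `iter_update_icb_apply_of_ne` through
`T4TriangularPushforward.apply_resample_eq`), `iter_extend_eq` (the level-`n` environment of a configuration resampled at the level-`(n+1)` pivots is the
old one resampled at the central bonds), ★★`cw_extend` (the iterated window is blind, via N09's `centralWindow_extend`); §3 ★★`chain_imageNull` — the chain
maps Haar-null subsets of its window (measurable or not) to Haar-null sets (part 1's PUSH level by level, `toMeasurable`).

HONEST FRAMING.  Bookkeeping over landed N09∕T4 letters; nothing of Bałaban's is asserted; WREG, S2β, `FluctuationComparisonRegPrIntL` (20520) and every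
other crux are NOT proved; rung R3 = YM₃ on T³ — NOT d = 4, NOT infinite volume, NOT a mass gap, NOT Clay.
-/

noncomputable section

open MeasureTheory Set Function Filter Topology
open scoped ENNReal NNReal
open Literature.MathematicalPhysics.QuantumFieldTheory.Balaban1983to89
open Literature.MathematicalPhysics.QuantumFieldTheory.Balaban1983to89.Node00 (SU)
open Literature.MathematicalPhysics.QuantumFieldTheory.Balaban1983to89.ExpMeanLog (expMeanLogSU deltaSU)
open Literature.MathematicalPhysics.QuantumFieldTheory.Balaban1983to89.BlockAveraging (Idx avgFun)
open Literature.MathematicalPhysics.QuantumFieldTheory.Balaban1983to89.BlockAveragingHaarAC (centralBond centralBond_injective pre post)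
open Literature.MathematicalPhysics.QuantumFieldTheory.Balaban1983to89.BlockAveragingEMLHaarAC (fibreFamily offCard)
open Summit.QuantumFields.YangMills.BalabanUVNodes.N09CentralWindowAtRecord (centralWindow_extend)
open Summit.QuantumFields.YangMills.Theorems.FluctuationComparisonRegPrIntLWregChartEdgeEngine (haar_image_eq_zero_of_subset_window)
open Summit.QuantumFields.YangMills.Theorems.FluctuationComparisonRegPrIntLWregChartChainLetters (iter_update_icb_apply_of_ne cm_zero_apply
  cm_succ_apply)

namespace Summit.QuantumFields.YangMills.Theorems.FluctuationComparisonRegPrIntLWregChartChainBlindness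

/-! ## §1  Resampling algebra; injectivity of the iterated central bond -/

section Resample

variable {ι κ κ' G : Type*}

/-- Updating a resampled family at a pivot = resampling with the updated private family. [folklore] -/
theorem update_extend_eq [DecidableEq ι] [DecidableEq κ] {β : κ → ι} (hβ : Injective β) (g : κ → G) (U : ι → G) (c : κ) (h : G) :
    update (extend β g U) (β c) h = extend β (update g c h) U := by
  funext x
  by_cases hr : ∃ b, β b = x
  · obtain ⟨b, rfl⟩ := hr
    by_cases hbc : b = c
    · subst hbc; rw [update_self, hβ.extend_apply, update_self]
    · have hne : β b ≠ β c := fun hh => hbc (hβ hh)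
      rw [update_of_ne hne, hβ.extend_apply, hβ.extend_apply, update_of_ne hbc]
  · have hne : x ≠ β c := fun hh => hr ⟨c, hh.symm⟩
    rw [update_of_ne hne, extend_apply' _ _ _ hr, extend_apply' _ _ _ hr]

/-- Resampling along a composite injection = resampling along the outer one with the inner-resampled private family. [folklore] -/
theorem extend_comp_eq {β : κ → ι} {γ : κ' → κ} (hβ : Injective β) (hγ : Injective γ) (g : κ' → G) (U : ι → G) :
    extend (β ∘ γ) g U = extend β (extend γ g (U ∘ β)) U := by
  classical
  funext x
  by_cases hr : ∃ b, β b = x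
  · obtain ⟨b, rfl⟩ := hr
    rw [hβ.extend_apply]
    by_cases hs : ∃ c, γ c = b
    · obtain ⟨c, rfl⟩ := hs
      rw [hγ.extend_apply]
      exact (hβ.comp hγ).extend_apply g U c
    · rw [extend_apply' _ _ _ hs,
        extend_apply' g U (β b) (show ¬ ∃ c, (β ∘ γ) c = β b from fun ⟨c, hc⟩ => hs ⟨c, hβ hc⟩)]
      rfl
  · rw [extend_apply' _ _ _ hr, extend_apply' g U x (show ¬ ∃ c, (β ∘ γ) c = x from fun ⟨c, hc⟩ => hr ⟨γ c, hc⟩)]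

end Resample

section Chain

variable {P : Params}

/-- The iterated central bond is injective in the standing range (from its recursion and one-step injectivity). [folklore] -/
theorem icb_injective (icb : (n : ℕ) → PBond P n → PBond P 0) (hicb0 : ∀ c, icb 0 c = c)
    (hicbS : ∀ n (c : PBond P (n + 1)), icb (n + 1) c = icb n (centralBond c)) :
    ∀ {n : ℕ}, n ≤ P.m + P.K → Injective (icb n) := by
  intro n
  induction n with
  | zero => intro _ c c' h; rwa [hicb0, hicb0] at h
  | succ n IH =>
      intro hn c c' h
      rw [hicbS, hicbS] at h
      exact centralBond_injective (by omega) (IH (by omega) h)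

variable {G : Type*} [GaugeGroup G]

/-! ## §2  Blindness of the chain and of its iterated window -/

/-- ★ **THE CHAIN AT `c` IS BLIND TO RESAMPLING ALL LEVEL-`n` PIVOT COORDINATES** (`n ≤ m + K`): `cm n (extend (icb n) g U) c = cm n U c` — triangularity of
the iterated averaging (`iter_update_icb_apply_of_ne`) through `T4TriangularPushforward.apply_resample_eq`. [cite: Balaban1987RG1, (0.4) p.253] -/
theorem cm_extend (ℰ : LoopAverage G) (icb : (n : ℕ) → PBond P n → PBond P 0) (hicb0 : ∀ c, icb 0 c = c)
    (hicbS : ∀ n (c : PBond P (n + 1)), icb (n + 1) c = icb n (centralBond c))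
    (cm : (n : ℕ) → GaugeField P 0 G → PBond P n → G → G)
    (hcm : ∀ n U c g, cm n U c g = Averaging.iter (fun i => BlockAveraging.blockAvg (P := P) (j := i) ℰ) n (update U (icb n c) g) c)
    {n : ℕ} (hn : n ≤ P.m + P.K) (g : PBond P n → G) (U : GaugeField P 0 G) (c : PBond P n) :
    cm n (extend (icb n) g U) c = cm n U c := by
  classical
  have hβ := icb_injective icb hicb0 hicbS hn
  have hloc : T4TriangularPushforward.IsLocal (icb n) (Averaging.iter (fun i => BlockAveraging.blockAvg (P := P) (j := i) ℰ) n) :=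
    fun U c g c' hc => iter_update_icb_apply_of_ne ℰ icb hicb0 hicbS hn U c g c' hc
  funext h
  rw [hcm, hcm, update_extend_eq hβ, T4TriangularPushforward.apply_resample_eq hloc hβ U (update g c h) c, update_self]

/-- ★ **THE LEVEL-`n` ENVIRONMENT OF A CONFIGURATION RESAMPLED AT THE LEVEL-`(n+1)` PIVOTS** is the old environment resampled at the central bonds, with the
chain values as the new private family (`n + 1 ≤ m + K`). [cite: Balaban1987RG1, (0.4) p.253] -/
theorem iter_extend_eq (ℰ : LoopAverage G) (icb : (n : ℕ) → PBond P n → PBond P 0) (hicb0 : ∀ c, icb 0 c = c)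
    (hicbS : ∀ n (c : PBond P (n + 1)), icb (n + 1) c = icb n (centralBond c))
    (cm : (n : ℕ) → GaugeField P 0 G → PBond P n → G → G)
    (hcm : ∀ n U c g, cm n U c g = Averaging.iter (fun i => BlockAveraging.blockAvg (P := P) (j := i) ℰ) n (update U (icb n c) g) c)
    {n : ℕ} (hn : n + 1 ≤ P.m + P.K) (g : PBond P (n + 1) → G) (U : GaugeField P 0 G) :
    Averaging.iter (fun i => BlockAveraging.blockAvg (P := P) (j := i) ℰ) n (extend (icb (n + 1)) g U) =
      extend centralBond (fun b => cm n U (centralBond b) (g b))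
        (Averaging.iter (fun i => BlockAveraging.blockAvg (P := P) (j := i) ℰ) n U) := by
  classical
  have hβ := icb_injective icb hicb0 hicbS (n := n) (by omega)
  have hcb : Injective (centralBond : PBond P (n + 1) → PBond P n) := centralBond_injective (by omega)
  have hloc : T4TriangularPushforward.IsLocal (icb n) (Averaging.iter (fun i => BlockAveraging.blockAvg (P := P) (j := i) ℰ) n) :=
    fun U c g c' hc => iter_update_icb_apply_of_ne ℰ icb hicb0 hicbS (by omega) U c g c' hc
  have hicb : (icb (n + 1) : PBond P (n + 1) → PBond P 0) = icb n ∘ centralBond := funext fun c => hicbS n c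
  have hE : extend (icb (n + 1)) g U = extend (icb n) (extend centralBond g (U ∘ icb n)) U := by
    rw [hicb]; exact extend_comp_eq hβ hcb g U
  rw [hE]
  funext b
  rw [T4TriangularPushforward.apply_resample_eq hloc hβ]
  by_cases hb : ∃ b', centralBond b' = b
  · obtain ⟨b', rfl⟩ := hb
    rw [hcb.extend_apply, hcb.extend_apply, hcm]
  · rw [extend_apply' _ _ _ hb, extend_apply' _ _ _ hb, Function.comp_apply, update_eq_self]

variable {N : ℕ} [NeZero N]

/-- ★★ **THE ITERATED WINDOW IS BLIND TO RESAMPLING ALL LEVEL-`n` PIVOT COORDINATES** (`n ≤ m + K`): `cw n (extend (icb n) g U) c = cw n U c` (recursion,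
`iter_extend_eq`, N09's `centralWindow_extend`, `cm_extend`). [cite: Balaban1987RG1, (0.4) p.253 (bookkeeping)] -/
theorem cw_extend {α : ℝ} (icb : (n : ℕ) → PBond P n → PBond P 0) (hicb0 : ∀ c, icb 0 c = c)
    (hicbS : ∀ n (c : PBond P (n + 1)), icb (n + 1) c = icb n (centralBond c))
    (cm : (n : ℕ) → GaugeField P 0 (SU N) → PBond P n → SU N → SU N)
    (cw : (n : ℕ) → GaugeField P 0 (SU N) → PBond P n → Set (SU N))
    (hcm : ∀ n U c g, cm n U c g =
      Averaging.iter (fun i => BlockAveraging.blockAvg (P := P) (j := i) (expMeanLogSU (n := Fin N))) n (update U (icb n c) g) c)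
    (hcw0 : ∀ U c, cw 0 U c = univ)
    (hcwS : ∀ n U (c : PBond P (n + 1)), cw (n + 1) U c = {g | g ∈ cw n U (centralBond c) ∧
      cm n U (centralBond c) g ∈ {h : SU N | ∀ i : Idx P,
        dist1 (fibreFamily (Averaging.iter (fun i => BlockAveraging.blockAvg (P := P) (j := i) (expMeanLogSU (n := Fin N))) n U) c
          (pre (Averaging.iter (fun i => BlockAveraging.blockAvg (P := P) (j := i) (expMeanLogSU (n := Fin N))) n U) c * h *
            post (Averaging.iter (fun i => BlockAveraging.blockAvg (P := P) (j := i) (expMeanLogSU (n := Fin N))) n U) c) i) ≤ α}}) :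
    ∀ {n : ℕ}, n ≤ P.m + P.K → ∀ (g : PBond P n → SU N) (U : GaugeField P 0 (SU N)) (c : PBond P n),
      cw n (extend (icb n) g U) c = cw n U c := by
  intro n
  induction n with
  | zero => intro _ g U c; rw [hcw0, hcw0]
  | succ n IH =>
      intro hn g U c
      classical
      have hβ := icb_injective icb hicb0 hicbS (n := n) (by omega)
      have hcb : Injective (centralBond : PBond P (n + 1) → PBond P n) := centralBond_injective (by omega)
      have hicb : (icb (n + 1) : PBond P (n + 1) → PBond P 0) = icb n ∘ centralBond := funext fun c => hicbS n c
      have hE : extend (icb (n + 1)) g U = extend (icb n) (extend centralBond g (U ∘ icb n)) U := by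
        rw [hicb]; exact extend_comp_eq hβ hcb g U
      have hwin : {h : SU N | ∀ i : Idx P,
          dist1 (fibreFamily (Averaging.iter (fun i => BlockAveraging.blockAvg (P := P) (j := i) (expMeanLogSU (n := Fin N))) n
              (extend (icb (n + 1)) g U)) c
            (pre (Averaging.iter (fun i => BlockAveraging.blockAvg (P := P) (j := i) (expMeanLogSU (n := Fin N))) n (extend (icb (n + 1)) g U)) c * h *
              post (Averaging.iter (fun i => BlockAveraging.blockAvg (P := P) (j := i) (expMeanLogSU (n := Fin N))) n (extend (icb (n + 1)) g U)) c)
            i) ≤ α} =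
          {h : SU N | ∀ i : Idx P,
            dist1 (fibreFamily (Averaging.iter (fun i => BlockAveraging.blockAvg (P := P) (j := i) (expMeanLogSU (n := Fin N))) n U) c
              (pre (Averaging.iter (fun i => BlockAveraging.blockAvg (P := P) (j := i) (expMeanLogSU (n := Fin N))) n U) c * h *
                post (Averaging.iter (fun i => BlockAveraging.blockAvg (P := P) (j := i) (expMeanLogSU (n := Fin N))) n U) c) i) ≤ α} := by
        rw [iter_extend_eq (expMeanLogSU (n := Fin N)) icb hicb0 hicbS cm hcm hn]
        exact centralWindow_extend (N := N) hn c α _ _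
      rw [hcwS, hcwS, hwin, hE, IH (by omega), cm_extend (expMeanLogSU (n := Fin N)) icb hicb0 hicbS cm hcm (by omega)]

/-! ## §3  Haar-null transport along the chain -/

/-- ★★ **THE CHAIN MAPS HAAR-NULL SUBSETS OF ITS WINDOW TO HAAR-NULL SETS** (`n ≤ m + K`; chart regime; the subset need not be measurable — `toMeasurable`):
`A ⊆ cw n U c → Haar A = 0 → Haar (cm n U c '' A) = 0`, by induction along the chain recursion with part 1's one-step PUSH on the central windows.
[cite: Balaban1987RG1, (0.4) p.253 and (2.10) p.267] -/
theorem chain_imageNull {α : ℝ} (hα0 : 0 ≤ α) (hα24 : α ≤ 1 / 24) (hα64 : 64 * α ≤ deltaSU (Fin N))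
    (hαL : 157 * α < ((P.L : ℝ) ^ (P.d - 1))⁻¹)
    (hgap : ∀ j (c : PBond P (j + 1)), (offCard c : ℝ) / (Fintype.card (Idx P) : ℝ) + 150 * α < 1)
    (icb : (n : ℕ) → PBond P n → PBond P 0) (hicb0 : ∀ c, icb 0 c = c)
    (hicbS : ∀ n (c : PBond P (n + 1)), icb (n + 1) c = icb n (centralBond c))
    (cm : (n : ℕ) → GaugeField P 0 (SU N) → PBond P n → SU N → SU N)
    (cw : (n : ℕ) → GaugeField P 0 (SU N) → PBond P n → Set (SU N))
    (hcm : ∀ n U c g, cm n U c g =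
      Averaging.iter (fun i => BlockAveraging.blockAvg (P := P) (j := i) (expMeanLogSU (n := Fin N))) n (update U (icb n c) g) c)
    (hcwS : ∀ n U (c : PBond P (n + 1)), cw (n + 1) U c = {g | g ∈ cw n U (centralBond c) ∧
      cm n U (centralBond c) g ∈ {h : SU N | ∀ i : Idx P,
        dist1 (fibreFamily (Averaging.iter (fun i => BlockAveraging.blockAvg (P := P) (j := i) (expMeanLogSU (n := Fin N))) n U) c
          (pre (Averaging.iter (fun i => BlockAveraging.blockAvg (P := P) (j := i) (expMeanLogSU (n := Fin N))) n U) c * h *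
            post (Averaging.iter (fun i => BlockAveraging.blockAvg (P := P) (j := i) (expMeanLogSU (n := Fin N))) n U) c) i) ≤ α}}) :
    ∀ {n : ℕ}, n ≤ P.m + P.K → ∀ (U : GaugeField P 0 (SU N)) (c : PBond P n) (A : Set (SU N)),
      A ⊆ cw n U c → (HaarData.haar : Measure (SU N)) A = 0 → (HaarData.haar : Measure (SU N)) (cm n U c '' A) = 0 := by
  intro n
  induction n with
  | zero =>
      intro _ U c A _ hA0
      have hid : cm 0 U c = id := funext fun g => cm_zero_apply _ icb hicb0 cm hcm U c g
      rwa [hid, image_id]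
  | succ n IH =>
      intro hn U c A hA hA0
      have hsub : A ⊆ cw n U (centralBond c) := fun g hg => by have := hA hg; rw [hcwS] at this; exact this.1
      have himg0 : (HaarData.haar : Measure (SU N)) (cm n U (centralBond c) '' A) = 0 := IH (by omega) U (centralBond c) A hsub hA0
      -- the intermediate image lies in the window; thicken it to a measurable null subset of the window
      generalize hW : Averaging.iter (fun i => BlockAveraging.blockAvg (P := P) (j := i) (expMeanLogSU (n := Fin N))) n U = W at hcwS ⊢
      have hcwS' := hcwS n U c
      have hsucc : ∀ g, cm (n + 1) U c g = avgFun (expMeanLogSU (n := Fin N)) (update W (centralBond c) (cm n U (centralBond c) g)) c := by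
        intro g; rw [← hW]; exact cm_succ_apply _ icb hicb0 hicbS cm hcm hn U c g
      rw [hW] at hcwS'
      have hwin : cm n U (centralBond c) '' A ⊆ {h : SU N | ∀ i : Idx P, dist1 (fibreFamily W c (pre W c * h * post W c) i) ≤ α} := by
        rintro _ ⟨g, hg, rfl⟩
        have := hA hg
        rw [hcwS'] at this
        exact this.2
      have hΩm : MeasurableSet {h : SU N | ∀ i : Idx P, dist1 (fibreFamily W c (pre W c * h * post W c) i) ≤ α} :=
        ((Summit.QuantumFields.YangMills.BalabanUVNodes.N09CentralWindowForwardLaw.isClosed_centralWindowW W c α).preimage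
          ((continuous_const.mul continuous_id).mul continuous_const)).measurableSet
      have hB := haar_image_eq_zero_of_subset_window (N := N) hn hα0 hα24 hα64 hαL (hgap n) W c
        ((measurableSet_toMeasurable _ _).inter hΩm) inter_subset_right
        (measure_mono_null inter_subset_left (by rw [measure_toMeasurable]; exact himg0))
      refine measure_mono_null ?_ hB
      rintro _ ⟨g, hg, rfl⟩
      refine ⟨cm n U (centralBond c) g, ⟨subset_toMeasurable _ _ ⟨g, hg, rfl⟩, hwin ⟨g, hg, rfl⟩⟩, (hsucc g).symm⟩

end Chain

end Summit.QuantumFields.YangMills.Theorems.FluctuationComparisonRegPrIntLWregChartChainBlindness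

end
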